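import Literature.Combinatorics.Optimization.ComplexPsdRankB4
import Literature.LinearAlgebra.Matrix.RankEigenvalueTraceBound
import Literature.LinearAlgebra.Matrix.RankMinors
import Mathlib.NumberTheory.Bertrand
import HarnessLib

/-!
# The real psd rank of `M_c = (c − 1)I + J` is `O(c√n)`, the rank of an `ε`-approximation of the
# identity is `≥ n/(1 + ε²(n−1))`, and `rank_psd(J − A)`, `rank_psd(A)` can be far apart
# (Lee–Wei–de Wolf 2017, §6.1 Prop. 42, §6.2 Theorem 46, Lemma 47, display p13) — PROVED

Source: T. Lee, Z. Wei, R. de Wolf, *Some upper and lower bounds on PSD-rank*, Math. Program. 162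
(2017) 495–521 = arXiv:1407.4308 [LeeWeiDeWolf2017]; held text `paper:arxiv-1407.4308`, p13–p14
(`pNN` = held-text chunk).

Printed statements (p13–p14, verbatim). "`M_c` = [the `n × n` matrix with `c` on the diagonal and `1`
elsewhere], where `c` could be any nonnegative real number … For `c = 0`, `M_c` is exactly the matrix
corresponding to the Nonequality function." "**Theorem 46.** If `c > 2`, `rank_psd^ℝ(M_c) ≤ 2⌈c⌉·⌈√n⌉`.
If `c ∈ [0,2]`, `rank_psd^ℝ(M_c) ≤ ⌈√(2n)⌉ + 1`." "**Lemma 47.** Let `c` be a positive integer and `q` be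
a prime number. There exists a family of `q²` `c`-element sets over a universe of size `cq`, such that
any two distinct sets from this family intersect in at most one point." (proof: `S_{ab} = {(x, ax+b) :
x ∈ [c]}` in `[c] × 𝔽_q`, "two distinct lines can intersect in at most one `(x,y)`-pair".) Printed proof
of Theorem 46 (p13–p14): for a family `S_1,…,S_n` of `c`-subsets of `[r]` pairwise meeting in at most
one point, "`E_i` … the submatrix whose row index set and column index set are `S_i` … a `c`-by-`c`
all-one matrix. All the other entries of `E_i` are set to `0`. `F_i` is similar to `E_i` except that all
its diagonal entries are `1` … if `x = y` then `Tr(E_xF_y) = c²`, and if `x ≠ y` then `Tr(E_xF_y) = c` …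
`{E_i/c}` and `{F_i}` form a size-`r` PSD-factorization of `M_c`"; `q` the smallest prime `≥ ⌈√n⌉`
(`q ≤ 2⌈√n⌉`), universe of size `cq`; for non-integer `c > 2` "replace all the nonzero off-diagonal
entries of the `E_i`'s (which are 1's) by `a = (c−1)/(⌈c⌉−1)`"; for `c = 2`, `p(r,2) = r(r−1)/2`, "if we
choose `r = ⌈√(2n)⌉ + 1`, it holds that `p(r,c) ≥ n`"; for `c ∈ [0,2)` "replace … by `c − 1`".
(p13) "We say that an `n`-by-`n` matrix `A` is an `ε`-approximation of the identity if `A(i,i) = 1` for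
all `i ∈ [n]` and `0 ≤ A(i,j) ≤ ε` for all `i ≠ j`. The usual rank of approximations of the identity has
been well studied [Alo09]. In particular, it is easy to show that if `A` is an `ε`-approximation of the
identity then `rank(A) ≥ n/(1 + ε²(n−1))`." (p13) "**Proposition 42.** For every positive integer `d`,
there exists a nonnegative matrix `A`, such that `J − A` is also nonnegative, and
`|rank_psd(J−A) − rank_psd(A)| > d`, where `J` is the all-one matrix. Proof. Choose `A = I`, and the size to
be `n`, then we have that `rank_psd(J−A) ≈ √n`, while `rank_psd(A) = n`."

## Contents (all PROVED; no named facts)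

* `lwdwMc n c` — the matrix `M_c`.
* The factors for a `C`-set `S` in a universe `U`: `lwdwE a S = (1−a)·D_S + a·1_S1_Sᵀ` (the printed
  `E_i` with off-diagonal entries `a`), `lwdwF S = 1_S1_Sᵀ + D_{Sᶜ}` (the printed `F_i`);
  `trace_lwdwE_mul_lwdwF` (`Tr(E_S F_T) = |S| + a(|S∩T|² − |S∩T|)`), `posSemidef_lwdwE`
  (`−1/(C−1) ≤ a ≤ 1`, via `E = (1 − a + aC)Π_S + (1−a)(D_S − Π_S)`), `posSemidef_lwdwF`.
* **`hasPsdFactorization_of_pairwise_inter_le_one`** — the printed mechanism in general: a family of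
  `C`-sets (`C ≥ 2`) pairwise meeting in `≤ 1` point over a universe of size `r` gives
  `rank_psd^ℝ(M_c) ≤ r` for every `0 ≤ c ≤ C` (with `a = (c−1)/(C−1)` and the factor `1/C`).
* `lwdwLine` and **`LeeWeiDeWolf2017_lemma47`** — the `q²` lines `{(x, ax+b)}` in `[c] × 𝔽_q`
  (`c ≤ q`), pairwise meeting in `≤ 1` point.
* **`LeeWeiDeWolf2017_thm46_gt_two`** (`c > 2`: size `2⌈c⌉⌈√n⌉`, Bertrand's postulate
  `Nat.exists_prime_lt_and_le_two_mul`), **`LeeWeiDeWolf2017_thm46_le_two`** (`0 ≤ c ≤ 2`: size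
  `⌈√(2n)⌉ + 1`, all `2`-subsets of `[r]`), **`LeeWeiDeWolf2017_thm46`** (both clauses as printed); the case
  `c = 0`: `rank_psd^ℝ` of the `n × n` nonequality matrix is `≤ ⌈√(2n)⌉ + 1`
  (`LeeWeiDeWolf2017_thm46_nonequality`).
* "`B₁(M_c) = √n`" (p13): `lwdwMc_eq` (`M_c = (c−1)I + J`), **`rank_lwdwMc`** (`= n` for `c ≠ 1`,
  `c − 1 + n ≠ 0`, explicit inverse), `le_sq_of_hasComplexPsdFactorization_lwdwMc` (`n ≤ r²`, Fact 4) and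
  `le_choose_of_hasPsdFactorization_lwdwMc` (`n ≤ C(r+1,2)`, FGPRT Prop. 2.5) — the lower bounds that make
  Theorem 46 tight up to `O(c)`.
* Appended (§6.2 display, p13): **`LeeWeiDeWolf2017_rank_approxIdentity`** (`n ≤ rank(A)(1 + ε²(n−1))`
  for unit diagonal and `|A(i,j)| ≤ ε`, via the tree's Horn–Johnson 2.4.P2 `|tr A|² ≤ rank A·Σ|a_ij|²`
  over `ℂ` and `rank_ℂ ≤ rank_ℝ` by vanishing minors), `LeeWeiDeWolf2017_rank_approxIdentity_div` (the
  printed quotient form, hypotheses as in `LeeWeiDeWolf2017_thm43_real`), `rank_offDiagConst` (`= n` for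
  `0 ≤ ε < 1`), and the Fact-4 consequences `LeeWeiDeWolf2017_approxIdentity_complexPsd`
  (`n ≤ r²(1 + ε²(n−1))`) / `LeeWeiDeWolf2017_approxIdentity_realPsd` (`n ≤ C(r+1,2)(1 + ε²(n−1))`).
* Appended (§6.1, p13): **`LeeWeiDeWolf2017_prop42`** ("for every `d` there is a nonnegative `A` with
  `J − A` nonnegative and `|rank_psd(J−A) − rank_psd(A)| > d`": `A = I_n`, `n = 2(d+2)²`, Theorem 46 for
  `J − I` and Theorem 43 (`ε = 0`, `LeeWeiDeWolf2017_thm43` of `ComplexPsdRankB4.lean`) for `I`; complex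
  psd rank as printed) and `LeeWeiDeWolf2017_prop42_real` (FGPRT Ex. 2.11 `hasPsdFactorization_one_iff`).
  Not here: Theorem 48 (Alon 2009) and Theorem 49 — the source [Alo09] is not held.
-/

noncomputable section

open Matrix Finset

namespace Literature.Combinatorics.Optimization

section ApproximateIdentity

/-- **The matrix `M_c`**: `c` on the diagonal, `1` elsewhere (`n × n`).
[cite: LeeWeiDeWolf2017, §6.2 (p13, display before Thm. 46)] -/
def lwdwMc (n : ℕ) (c : ℝ) : Matrix (Fin n) (Fin n) ℝ := Matrix.of fun i j => if i = j then c else 1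

/-! ### The factors `E_S`, `F_S` of a set `S` -/

variable {U : Type*} [Fintype U] [DecidableEq U]

/-- The indicator vector `1_S`. [cite: LeeWeiDeWolf2017, Thm. 46 proof (p13)] -/
def indVec (S : Finset U) : U → ℝ := fun u => if u ∈ S then 1 else 0

/-- The printed `E_i` with off-diagonal entries `a` on `S × S`: `E = (1−a)·D_S + a·1_S1_Sᵀ`
(`a = 1`: the all-one block on `S × S`). [cite: LeeWeiDeWolf2017, Thm. 46 proof (p13–p14)] -/
def lwdwE (a : ℝ) (S : Finset U) : Matrix U U ℝ :=
  (1 - a) • Matrix.diagonal (indVec S) + a • Matrix.vecMulVec (indVec S) (indVec S)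

/-- The printed `F_i`: the all-one block on `S × S` and `1` on the rest of the diagonal,
`F = 1_S1_Sᵀ + D_{Sᶜ}`. [cite: LeeWeiDeWolf2017, Thm. 46 proof (p13)] -/
def lwdwF (S : Finset U) : Matrix U U ℝ :=
  Matrix.vecMulVec (indVec S) (indVec S) + Matrix.diagonal (indVec Sᶜ)

omit [Fintype U] in
/-- `1_S(u)² = 1_S(u)`. [folklore] -/
private theorem indVec_mul_self (S : Finset U) (u : U) : indVec S u * indVec S u = indVec S u := by
  unfold indVec; split_ifs <;> simp

omit [Fintype U] in
/-- `1_S(u) 1_T(u) = 1_{S∩T}(u)`. [folklore] -/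
private theorem indVec_mul (S T : Finset U) (u : U) : indVec S u * indVec T u = indVec (S ∩ T) u := by
  unfold indVec
  by_cases hS : u ∈ S <;> by_cases hT : u ∈ T <;> simp [hS, hT, Finset.mem_inter]

/-- `Σ_u 1_S(u) = |S|`. [folklore] -/
private theorem sum_indVec (S : Finset U) : ∑ u, indVec S u = S.card := by
  unfold indVec
  rw [Finset.sum_boole]
  simp

/-- `1_S · 1_T = |S ∩ T|`. [folklore] -/
private theorem indVec_dotProduct (S T : Finset U) : indVec S ⬝ᵥ indVec T = (S ∩ T).card := by
  simp only [dotProduct, indVec_mul, sum_indVec]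

/-- `Tr(D_v M) = Σ v_u M_uu`. [folklore] -/
private theorem trace_diagonal_mul' (v : U → ℝ) (M : Matrix U U ℝ) :
    (Matrix.diagonal v * M).trace = ∑ u, v u * M u u := by
  simp [Matrix.trace, Matrix.diagonal_mul]

/-- `Tr(M D_v) = Σ M_uu v_u`. [folklore] -/
private theorem trace_mul_diagonal' (v : U → ℝ) (M : Matrix U U ℝ) :
    (M * Matrix.diagonal v).trace = ∑ u, M u u * v u := by
  simp [Matrix.trace, Matrix.mul_diagonal]

/-- **`Tr(E_S F_T) = |S| + a(|S∩T|² − |S∩T|)`** (`= c²`-type value for `S = T`, `= |S|` when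
`|S ∩ T| ≤ 1`: "if `x = y` then `Tr(E_xF_y) = c²`, and if `x ≠ y` then `Tr(E_xF_y) = c`").
[cite: LeeWeiDeWolf2017, Thm. 46 proof (p13–p14)] -/
theorem trace_lwdwE_mul_lwdwF (a : ℝ) (S T : Finset U) :
    (lwdwE a S * lwdwF T).trace =
      S.card + a * (((S ∩ T).card : ℝ) ^ 2 - (S ∩ T).card) := by
  have h1 : (Matrix.diagonal (indVec S) * Matrix.vecMulVec (indVec T) (indVec T)).trace =
      ((S ∩ T).card : ℝ) := by
    rw [trace_diagonal_mul']
    simp only [Matrix.vecMulVec_apply]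
    rw [← sum_indVec (S ∩ T)]
    refine Finset.sum_congr rfl fun u _ => ?_
    rw [indVec_mul_self, indVec_mul]
  have h2 : (Matrix.diagonal (indVec S) * Matrix.diagonal (indVec Tᶜ)).trace =
      (S.card : ℝ) - (S ∩ T).card := by
    rw [trace_diagonal_mul']
    simp only [Matrix.diagonal_apply_eq]
    simp_rw [indVec_mul, sum_indVec]
    have : S ∩ Tᶜ = S \ T := by ext u; simp [Finset.mem_sdiff]
    rw [this, ← Finset.card_sdiff_add_card_inter S T]
    push_cast
    ring
  have h3 : (Matrix.vecMulVec (indVec S) (indVec S) * Matrix.vecMulVec (indVec T) (indVec T)).trace =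
      ((S ∩ T).card : ℝ) ^ 2 := by
    rw [Matrix.vecMulVec_mul_vecMulVec, Matrix.trace_vecMulVec, dotProduct_smul, indVec_dotProduct,
      smul_eq_mul, sq]
  have h4 : (Matrix.vecMulVec (indVec S) (indVec S) * Matrix.diagonal (indVec Tᶜ)).trace =
      (S.card : ℝ) - (S ∩ T).card := by
    rw [trace_mul_diagonal']
    simp only [Matrix.vecMulVec_apply]
    simp_rw [indVec_mul_self, indVec_mul, sum_indVec]
    have : S ∩ Tᶜ = S \ T := by ext u; simp [Finset.mem_sdiff]
    rw [this, ← Finset.card_sdiff_add_card_inter S T]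
    push_cast
    ring
  rw [lwdwE, lwdwF, add_mul, mul_add, mul_add, Matrix.smul_mul, Matrix.smul_mul, Matrix.smul_mul,
    Matrix.smul_mul, trace_add, trace_add, trace_add, trace_smul, trace_smul, trace_smul, trace_smul,
    h1, h2, h3, h4, smul_eq_mul, smul_eq_mul, smul_eq_mul, smul_eq_mul]
  ring

/-- `F_T ⪰ 0`. [cite: LeeWeiDeWolf2017, Thm. 46 proof (p13, "both E_i and F_i are positive semidefinite")] -/
theorem posSemidef_lwdwF (T : Finset U) : (lwdwF T).PosSemidef := by
  refine (Matrix.posSemidef_vecMulVec_self_star (indVec T)).add (Matrix.PosSemidef.diagonal fun u => ?_)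
  unfold indVec; split_ifs <;> norm_num

/-- `D_S 1_S1_Sᵀ = 1_S1_Sᵀ`. [folklore] -/
private theorem diagonal_mul_vecMulVec_ind (S : Finset U) :
    Matrix.diagonal (indVec S) * Matrix.vecMulVec (indVec S) (indVec S) =
      Matrix.vecMulVec (indVec S) (indVec S) := by
  ext u v
  rw [Matrix.diagonal_mul, Matrix.vecMulVec_apply, ← mul_assoc, indVec_mul_self]

/-- `1_S1_Sᵀ D_S = 1_S1_Sᵀ`. [folklore] -/
private theorem vecMulVec_ind_mul_diagonal (S : Finset U) :
    Matrix.vecMulVec (indVec S) (indVec S) * Matrix.diagonal (indVec S) =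
      Matrix.vecMulVec (indVec S) (indVec S) := by
  ext u v
  rw [Matrix.mul_diagonal, Matrix.vecMulVec_apply, mul_assoc, indVec_mul_self]

/-- `D_S² = D_S`. [folklore] -/
private theorem diagonal_ind_mul_self (S : Finset U) :
    Matrix.diagonal (indVec S) * Matrix.diagonal (indVec S) = Matrix.diagonal (indVec S) := by
  rw [Matrix.diagonal_mul_diagonal]
  congr 1; funext u; exact indVec_mul_self S u

/-- `(1_S1_Sᵀ)² = |S|·1_S1_Sᵀ`. [folklore] -/
private theorem vecMulVec_ind_mul_self (S : Finset U) :
    Matrix.vecMulVec (indVec S) (indVec S) * Matrix.vecMulVec (indVec S) (indVec S) =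
      (S.card : ℝ) • Matrix.vecMulVec (indVec S) (indVec S) := by
  rw [Matrix.vecMulVec_mul_vecMulVec, indVec_dotProduct, Finset.inter_self]
  ext u v
  simp [Matrix.vecMulVec_apply, Matrix.smul_apply]
  ring

/-- **`E_S ⪰ 0` for `−1/(|S|−1) ≤ a ≤ 1`** (`|S| ≥ 2`): `E = (1 − a + a|S|)·Π_S + (1 − a)·(D_S − Π_S)` with
`Π_S = 1_S1_Sᵀ/|S|` and `D_S − Π_S` orthogonal projections ("both `E_i` and `F_i` are positive
semidefinite"; for the rescaled entries `a = (c−1)/(⌈c⌉−1)`, `c − 1`).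
[cite: LeeWeiDeWolf2017, Thm. 46 proof (p13–p14)] -/
theorem posSemidef_lwdwE {a : ℝ} (S : Finset U) (hS : 2 ≤ S.card) (ha1 : a ≤ 1)
    (ha0 : -1 / ((S.card : ℝ) - 1) ≤ a) : (lwdwE a S).PosSemidef := by
  set C : ℝ := (S.card : ℝ) with hC
  have hC2 : (2 : ℝ) ≤ C := by rw [hC]; exact_mod_cast hS
  have hC0 : C ≠ 0 := by linarith
  set V := Matrix.vecMulVec (indVec S) (indVec S) with hV
  set D := Matrix.diagonal (indVec S) with hD
  set Q : Matrix U U ℝ := C⁻¹ • V with hQdef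
  -- `D − Q` (`Q = Π_S`) is a symmetric idempotent, hence psd
  have hQ : (D - Q) * (D - Q) = D - Q := by
    rw [sub_mul, mul_sub, mul_sub, hQdef, Matrix.mul_smul, Matrix.smul_mul, Matrix.smul_mul, Matrix.mul_smul,
      hD, hV, diagonal_ind_mul_self, diagonal_mul_vecMulVec_ind, vecMulVec_ind_mul_diagonal,
      vecMulVec_ind_mul_self, ← hC, smul_smul, smul_smul, show C⁻¹ * C⁻¹ * C = C⁻¹ by field_simp]
    abel
  have hQt : (D - Q)ᴴ = D - Q := by
    rw [conjTranspose_sub, hD, hQdef, hV, Matrix.diagonal_conjTranspose, conjTranspose_smul,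
      Matrix.conjTranspose_vecMulVec]
    simp
  have hQpsd : (D - Q).PosSemidef := by
    have h := posSemidef_conjTranspose_mul_self (D - Q)
    rwa [hQt, hQ] at h
  have hQpsd0 : Q.PosSemidef := by
    rw [hQdef, hV]
    exact (Matrix.posSemidef_vecMulVec_self_star (indVec S)).smul (by positivity)
  -- the decomposition
  have hE : lwdwE a S = (1 - a + a * C) • Q + (1 - a) • (D - Q) := by
    rw [lwdwE, ← hV, ← hD, hQdef, smul_sub, smul_smul, smul_smul]
    have : (1 - a + a * C) * C⁻¹ = (1 - a) * C⁻¹ + a := by field_simp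
    rw [this, add_smul]
    abel
  rw [hE]
  refine (hQpsd0.smul ?_).add (hQpsd.smul (by linarith))
  -- `1 − a + aC ≥ 0` from `a ≥ −1/(C−1)`
  have hC1 : (0 : ℝ) < C - 1 := by linarith
  have : -1 ≤ a * (C - 1) := by
    have h := mul_le_mul_of_nonneg_right ha0 hC1.le
    rwa [div_mul_cancel₀ _ hC1.ne'] at h
  linarith

/-! ### The mechanism of Theorem 46: partial linear spaces give psd factorizations of `M_c` -/

/-- **The printed construction, in general**: if `S_p` (`p ∈ P`) are `C`-subsets (`C ≥ 2`) of a universe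
`U` of size `r`, pairwise meeting in at most one point, then for every `0 ≤ c ≤ C` the matrix `M_c` on
`P` (`c` on the diagonal, `1` elsewhere) has a real psd factorization of size `r`: `A_p = E_p/C` with
off-diagonal entries `a = (c−1)/(C−1)`, `B_p = F_p`. [cite: LeeWeiDeWolf2017, Thm. 46 proof (p13–p14)] -/
theorem hasPsdFactorization_of_pairwise_inter_le_one {P : Type*} (S : P → Finset U) {C : ℕ}
    (hC : 2 ≤ C) (hcard : ∀ p, (S p).card = C) (hint : ∀ p p', p ≠ p' → (S p ∩ S p').card ≤ 1)
    {c : ℝ} (hc0 : 0 ≤ c) (hcC : c ≤ C) [DecidableEq P] :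
    HasPsdFactorization (fun p p' : P => if p = p' then c else (1 : ℝ)) (Fintype.card U) := by
  classical
  set a : ℝ := (c - 1) / ((C : ℝ) - 1) with ha
  have hC2 : (2 : ℝ) ≤ C := by exact_mod_cast hC
  have hC1 : (0 : ℝ) < (C : ℝ) - 1 := by linarith
  have hCpos : (0 : ℝ) < C := by linarith
  have ha1 : a ≤ 1 := by rw [ha, div_le_one hC1]; linarith
  have ha0 : -1 / ((C : ℝ) - 1) ≤ a := by
    rw [ha]; exact div_le_div_of_nonneg_right (by linarith) hC1.le
  let e : U ≃ Fin (Fintype.card U) := Fintype.equivFin U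
  have htr : ∀ Z : Matrix U U ℝ, (Z.submatrix e.symm e.symm).trace = Z.trace := fun Z => by
    simp only [Matrix.trace, Matrix.diag_apply, Matrix.submatrix_apply]
    exact Fintype.sum_equiv e.symm _ _ fun x => rfl
  refine ⟨fun p => ((C : ℝ)⁻¹ • lwdwE a (S p)).submatrix e.symm e.symm,
    fun p' => (lwdwF (S p')).submatrix e.symm e.symm, fun p => ?_, fun p' => ?_, fun p p' => ?_⟩
  · refine Matrix.PosSemidef.submatrix ?_ _
    refine (posSemidef_lwdwE (S p) (by rw [hcard p]; exact hC) ha1 ?_).smul (by positivity)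
    rw [hcard p]; exact ha0
  · exact (posSemidef_lwdwF (S p')).submatrix _
  · rw [submatrix_mul_equiv, htr, Matrix.smul_mul, trace_smul, smul_eq_mul, trace_lwdwE_mul_lwdwF,
      hcard p]
    by_cases hpp : p = p'
    · subst hpp
      dsimp only
      rw [if_pos rfl, Finset.inter_self, hcard p, ha]
      field_simp
      ring
    · dsimp only
      rw [if_neg hpp]
      have hm : ((S p ∩ S p').card : ℝ) ^ 2 - (S p ∩ S p').card = 0 := by
        have h01 := hint p p' hpp
        interval_cases (S p ∩ S p').card <;> norm_num
      rw [hm, mul_zero, add_zero, inv_mul_cancel₀ hCpos.ne']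

/-- Transport along an injection of the index set: a psd factorization of `M_c` on `P` gives one of
the `n × n` matrix `M_c` for `ι : [n] ↪ P`. [cite: LeeWeiDeWolf2017, Thm. 46 proof (p13, "if p(r,c) ≥ n")] -/
theorem hasPsdFactorization_lwdwMc_of_embedding {P : Type*} [DecidableEq P] {n r : ℕ} {c : ℝ}
    (ι : Fin n ↪ P) (h : HasPsdFactorization (fun p p' : P => if p = p' then c else (1 : ℝ)) r) :
    HasPsdFactorization (lwdwMc n c) r := by
  have h' := h.submatrix ι ι
  have heq : (fun i j : Fin n => if ι i = ι j then c else (1 : ℝ)) = lwdwMc n c := by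
    funext i j
    simp [lwdwMc, ι.injective.eq_iff]
  rw [heq] at h'
  exact h'

/-! ### Lemma 47: lines in `[c] × 𝔽_q` -/

/-- **The sets `S_{ab} = {(x, ax + b) : x ∈ [c]}`** in the universe `[c] × 𝔽_q`.
[cite: LeeWeiDeWolf2017, Lemma 47 proof (p13)] -/
def lwdwLine (q c : ℕ) (p : ZMod q × ZMod q) : Finset (Fin c × ZMod q) :=
  Finset.univ.image fun x : Fin c => (x, p.1 * ((x : ℕ) : ZMod q) + p.2)

/-- `|S_{ab}| = c`. [cite: LeeWeiDeWolf2017, Lemma 47 (p13, "c-element sets")] -/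
theorem card_lwdwLine (q c : ℕ) (p : ZMod q × ZMod q) : (lwdwLine q c p).card = c := by
  rw [lwdwLine, Finset.card_image_of_injective _ (fun x y h => (Prod.mk.inj h).1), Finset.card_univ,
    Fintype.card_fin]

/-- **"Two distinct lines can intersect in at most one `(x,y)`-pair"** (`q` prime, `c ≤ q` so that the
`x`-coordinates `0, …, c−1` are distinct in `𝔽_q`). [cite: LeeWeiDeWolf2017, Lemma 47 proof (p13–p14)] -/
theorem card_lwdwLine_inter_le_one {q c : ℕ} [Fact q.Prime] (hc : c ≤ q) {p p' : ZMod q × ZMod q}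
    (hp : p ≠ p') : (lwdwLine q c p ∩ lwdwLine q c p').card ≤ 1 := by
  rw [Finset.card_le_one]
  intro u hu v hv
  rw [Finset.mem_inter] at hu hv
  simp only [lwdwLine, Finset.mem_image, Finset.mem_univ, true_and] at hu hv
  obtain ⟨⟨x1, hx1⟩, ⟨x1', hx1'⟩⟩ := hu
  obtain ⟨⟨x2, hx2⟩, ⟨x2', hx2'⟩⟩ := hv
  -- the `x`-coordinates of the two descriptions agree
  have e1 : x1' = x1 := by have := congrArg Prod.fst hx1'; rw [← hx1] at this; exact this
  have e2 : x2' = x2 := by have := congrArg Prod.fst hx2'; rw [← hx2] at this; exact this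
  rw [e1] at hx1'
  rw [e2] at hx2'
  have hy1 : p.1 * ((x1 : ℕ) : ZMod q) + p.2 = p'.1 * ((x1 : ℕ) : ZMod q) + p'.2 := by
    have := congrArg Prod.snd hx1'; rw [← hx1] at this; exact this.symm
  have hy2 : p.1 * ((x2 : ℕ) : ZMod q) + p.2 = p'.1 * ((x2 : ℕ) : ZMod q) + p'.2 := by
    have := congrArg Prod.snd hx2'; rw [← hx2] at this; exact this.symm
  -- `(a − a')(x1 − x2) = 0` with `a ≠ a'` (else `b = b'`)
  have hkey : (p.1 - p'.1) * (((x1 : ℕ) : ZMod q) - ((x2 : ℕ) : ZMod q)) = 0 := by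
    linear_combination hy1 - hy2
  rcases mul_eq_zero.mp hkey with h | h
  · exfalso
    apply hp
    have ha : p.1 = p'.1 := sub_eq_zero.mp h
    have hb : p.2 = p'.2 := by rw [ha] at hy1; exact add_left_cancel hy1
    exact Prod.ext ha hb
  · have hx : x1 = x2 := by
      have h' : ((x1 : ℕ) : ZMod q) = ((x2 : ℕ) : ZMod q) := sub_eq_zero.mp h
      rw [ZMod.natCast_eq_natCast_iff'] at h'
      rw [Nat.mod_eq_of_lt (lt_of_lt_of_le x1.2 hc), Nat.mod_eq_of_lt (lt_of_lt_of_le x2.2 hc)] at h'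
      exact Fin.ext h'
    rw [← hx1, ← hx2, hx]

/-- **LWdW Lemma 47** (p13, verbatim: "Let `c` be a positive integer and `q` be a prime number. There
exists a family of `q²` `c`-element sets over a universe of size `cq`, such that any two distinct sets from
this family intersect in at most one point"), for `c ≤ q` (the printed sets `{(x, ax+b) : x ∈ [c]}` need
`[c] ⊆ 𝔽_q`; in the application `c ≤ q` or the bound is trivial). [cite: LeeWeiDeWolf2017, Lemma 47 (p13–p14)] -/
theorem LeeWeiDeWolf2017_lemma47 {q c : ℕ} [Fact q.Prime] (hc : c ≤ q) :
    ∃ S : ZMod q × ZMod q → Finset (Fin c × ZMod q),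
      Fintype.card (ZMod q × ZMod q) = q ^ 2 ∧ Fintype.card (Fin c × ZMod q) = c * q ∧
      (∀ p, (S p).card = c) ∧ ∀ p p', p ≠ p' → (S p ∩ S p').card ≤ 1 :=
  ⟨lwdwLine q c, by simp [ZMod.card, sq], by simp [ZMod.card],
    card_lwdwLine q c, fun _ _ hp => card_lwdwLine_inter_le_one hc hp⟩

/-! ### Theorem 46 -/

/-- `n ≤ ⌈√n⌉²`. [folklore] -/
private theorem le_ceil_sqrt_sq (n : ℕ) : n ≤ ⌈Real.sqrt n⌉₊ ^ 2 := by
  have h1 : (n : ℝ) = Real.sqrt n ^ 2 := (Real.sq_sqrt (Nat.cast_nonneg n)).symm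
  have h2 : Real.sqrt n ≤ ⌈Real.sqrt n⌉₊ := Nat.le_ceil _
  have h3 : (n : ℝ) ≤ (⌈Real.sqrt n⌉₊ : ℝ) ^ 2 :=
    calc (n : ℝ) = Real.sqrt n ^ 2 := h1
      _ ≤ (⌈Real.sqrt n⌉₊ : ℝ) ^ 2 := pow_le_pow_left₀ (Real.sqrt_nonneg _) h2 2
  exact_mod_cast h3

/-- The trivial factorization: `rank_psd^ℝ(M_c) ≤ n` for `c ≥ 0`. [cite: LeeWeiDeWolf2017, §2 (p05, Def. 1)] -/
theorem hasPsdFactorization_lwdwMc_card (n : ℕ) {c : ℝ} (hc : 0 ≤ c) : HasPsdFactorization (lwdwMc n c) n := by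
  have h := HasPsdFactorization.of_entry_nonneg_card_rows (M := (lwdwMc n c : Fin n → Fin n → ℝ))
    (fun i j => by unfold lwdwMc; rw [Matrix.of_apply]; split_ifs <;> [exact hc; norm_num])
  rwa [Fintype.card_fin] at h

/-- **LWdW Theorem 46, first clause** (p13, verbatim: "If `c > 2`, `rank_psd^ℝ(M_c) ≤ 2⌈c⌉·⌈√n⌉`"):
Lemma 47 with `⌈c⌉`-element lines over the smallest prime `q ≥ ⌈√n⌉` (`q ≤ 2⌈√n⌉`, Bertrand), universe of
size `⌈c⌉q`; off-diagonal entries `a = (c−1)/(⌈c⌉−1)`. (If `⌈c⌉ > q` the bound exceeds `n` and the trivial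
factorization serves.) [cite: LeeWeiDeWolf2017, Thm. 46 (p13–p14)] -/
theorem LeeWeiDeWolf2017_thm46_gt_two (n : ℕ) {c : ℝ} (hc : 2 < c) :
    HasPsdFactorization (lwdwMc n c) (2 * ⌈c⌉₊ * ⌈Real.sqrt n⌉₊) := by
  classical
  set C := ⌈c⌉₊ with hCdef
  set m := ⌈Real.sqrt n⌉₊ with hmdef
  have hcC : c ≤ C := Nat.le_ceil c
  have hC3 : 3 ≤ C := by
    have : (2 : ℝ) < C := lt_of_lt_of_le hc hcC
    exact_mod_cast (show (2 : ℝ) < (C : ℝ) from this)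
  rcases Nat.eq_zero_or_pos n with rfl | hn
  · exact (hasPsdFactorization_lwdwMc_card 0 (by linarith)).mono (Nat.zero_le _)
  have hm : m ≠ 0 := by
    intro h0
    have := le_ceil_sqrt_sq n
    rw [← hmdef, h0] at this
    omega
  obtain ⟨q, hq, hmq, hq2⟩ := Nat.exists_prime_lt_and_le_two_mul m hm
  haveI : Fact q.Prime := ⟨hq⟩
  have hnm : n ≤ m ^ 2 := le_ceil_sqrt_sq n
  by_cases hCq : C ≤ q
  · -- the design on `[C] × 𝔽_q`
    have hnq : n ≤ Fintype.card (ZMod q × ZMod q) := by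
      rw [Fintype.card_prod, ZMod.card]; nlinarith
    let ι : Fin n ↪ ZMod q × ZMod q :=
      (Fin.castLEEmb hnq).trans (Fintype.equivFin (ZMod q × ZMod q)).symm.toEmbedding
    have h := hasPsdFactorization_of_pairwise_inter_le_one (U := Fin C × ZMod q) (lwdwLine q C)
      (by omega) (card_lwdwLine q C) (fun p p' hp => card_lwdwLine_inter_le_one hCq hp)
      (by linarith) hcC
    have h' := hasPsdFactorization_lwdwMc_of_embedding ι h
    refine h'.mono ?_
    rw [Fintype.card_prod, Fintype.card_fin, ZMod.card]
    calc C * q ≤ C * (2 * m) := Nat.mul_le_mul_left _ hq2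
      _ = 2 * C * m := by ring
  · -- `⌈c⌉ > q ≥ ⌈√n⌉`: the bound is at least `n`
    refine (hasPsdFactorization_lwdwMc_card n (by linarith)).mono ?_
    have hCq' := not_le.mp hCq
    calc n ≤ m ^ 2 := hnm
      _ = m * m := sq m
      _ ≤ m * q := Nat.mul_le_mul_left _ hmq.le
      _ ≤ m * C := Nat.mul_le_mul_left _ hCq'.le
      _ ≤ 2 * C * m := by nlinarith

/-- Distinct `2`-subsets meet in at most one point. [folklore] -/
private theorem card_inter_le_one_of_card_two {r : ℕ} {s t : Finset (Fin r)} (hs : s.card = 2)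
    (ht : t.card = 2) (hst : s ≠ t) : (s ∩ t).card ≤ 1 := by
  by_contra h
  have h2 : 2 ≤ (s ∩ t).card := by omega
  have hs' : s ∩ t = s := Finset.eq_of_subset_of_card_le Finset.inter_subset_left (by rw [hs]; exact h2)
  have ht' : s ∩ t = t := Finset.eq_of_subset_of_card_le Finset.inter_subset_right (by rw [ht]; exact h2)
  exact hst (hs'.symm.trans ht')

/-- `2n ≤ r(r−1)` for `r = ⌈√(2n)⌉ + 1` ("if we choose `r = ⌈√(2n)⌉ + 1`, it holds that `p(r,c) ≥ n`").
[cite: LeeWeiDeWolf2017, Thm. 46 proof (p14)] -/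
private theorem le_choose_two_of_ceil_sqrt (n : ℕ) :
    n ≤ (⌈Real.sqrt (2 * n)⌉₊ + 1).choose 2 := by
  set r := ⌈Real.sqrt (2 * n)⌉₊ with hr
  have h1 : (2 * n : ℝ) = Real.sqrt (2 * n) ^ 2 := (Real.sq_sqrt (by positivity)).symm
  have h2 : Real.sqrt (2 * n) ≤ r := Nat.le_ceil _
  have h3 : (2 * n : ℝ) ≤ (r : ℝ) ^ 2 :=
    calc (2 * n : ℝ) = Real.sqrt (2 * n) ^ 2 := h1
      _ ≤ (r : ℝ) ^ 2 := pow_le_pow_left₀ (Real.sqrt_nonneg _) h2 2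
  have h4 : 2 * n ≤ r ^ 2 := by exact_mod_cast h3
  rw [Nat.choose_two_right, Nat.add_sub_cancel]
  have : r ^ 2 ≤ (r + 1) * r := by nlinarith
  omega

/-- **LWdW Theorem 46, second clause** (p13, verbatim: "If `c ∈ [0,2]`, `rank_psd^ℝ(M_c) ≤ ⌈√(2n)⌉ + 1`"):
all `2`-subsets of `[r]`, `r = ⌈√(2n)⌉ + 1` (`p(r,2) = r(r−1)/2 ≥ n`), off-diagonal entries `c − 1`.
[cite: LeeWeiDeWolf2017, Thm. 46 (p13–p14)] -/
theorem LeeWeiDeWolf2017_thm46_le_two (n : ℕ) {c : ℝ} (hc0 : 0 ≤ c) (hc2 : c ≤ 2) :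
    HasPsdFactorization (lwdwMc n c) (⌈Real.sqrt (2 * n)⌉₊ + 1) := by
  classical
  set r := ⌈Real.sqrt (2 * n)⌉₊ + 1 with hr
  -- the `2`-subsets of `[r]` as an index type
  let P := {s : Finset (Fin r) // s ∈ Finset.powersetCard 2 (Finset.univ : Finset (Fin r))}
  have hPcard : Fintype.card P = r.choose 2 := by
    rw [Fintype.card_coe, Finset.card_powersetCard, Finset.card_univ, Fintype.card_fin]
  have hmem : ∀ s : P, s.1.card = 2 := fun s => (Finset.mem_powersetCard.mp s.2).2
  have hn : n ≤ Fintype.card P := by rw [hPcard]; exact le_choose_two_of_ceil_sqrt n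
  let ι : Fin n ↪ P := (Fin.castLEEmb hn).trans (Fintype.equivFin P).symm.toEmbedding
  have h := hasPsdFactorization_of_pairwise_inter_le_one (U := Fin r) (fun s : P => s.1) (le_refl 2)
    hmem (fun s t hst => card_inter_le_one_of_card_two (hmem s) (hmem t)
      (fun h => hst (Subtype.ext h))) hc0 (by exact_mod_cast hc2)
  have h' := hasPsdFactorization_lwdwMc_of_embedding ι h
  rwa [Fintype.card_fin] at h'

/-- **LWdW Theorem 46** (p13, verbatim: "If `c > 2`, `rank_psd^ℝ(M_c) ≤ 2⌈c⌉·⌈√n⌉`. If `c ∈ [0,2]`,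
`rank_psd^ℝ(M_c) ≤ ⌈√(2n)⌉ + 1`"). [cite: LeeWeiDeWolf2017, Thm. 46 (p13–p14)] -/
theorem LeeWeiDeWolf2017_thm46 (n : ℕ) {c : ℝ} (hc0 : 0 ≤ c) :
    (2 < c → HasPsdFactorization (lwdwMc n c) (2 * ⌈c⌉₊ * ⌈Real.sqrt n⌉₊)) ∧
      (c ≤ 2 → HasPsdFactorization (lwdwMc n c) (⌈Real.sqrt (2 * n)⌉₊ + 1)) :=
  ⟨fun hc => LeeWeiDeWolf2017_thm46_gt_two n hc, fun hc => LeeWeiDeWolf2017_thm46_le_two n hc0 hc⟩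

/-- **The case `c = 0`** ("For `c = 0`, `M_c` is exactly the matrix corresponding to the Nonequality
function"): the REAL psd rank of the `n × n` nonequality (= derangement) matrix is at most `⌈√(2n)⌉ + 1`
(compare FGPRT Ex. 5.1: it is exactly `min{k : n ≤ C(k+1,2)}`). [cite: LeeWeiDeWolf2017, Thm. 46 (p13)] -/
theorem LeeWeiDeWolf2017_thm46_nonequality (n : ℕ) :
    HasPsdFactorization (derangementMatrix n) (⌈Real.sqrt (2 * n)⌉₊ + 1) := by
  have h := LeeWeiDeWolf2017_thm46_le_two n le_rfl (by norm_num : (0 : ℝ) ≤ 2)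
  have heq : lwdwMc n 0 = derangementMatrix n := by
    funext i j; simp [lwdwMc, derangementMatrix]
  rw [heq] at h
  exact h

/-! ### `B₁(M_c) = √n`: `M_c` has full rank (`c ≠ 1`) -/

/-- The all-ones matrix `J_n`. [cite: LeeWeiDeWolf2017, §6.2 (p13, "J is the all-one matrix")] -/
def lwdwJ (n : ℕ) : Matrix (Fin n) (Fin n) ℝ := Matrix.of fun _ _ => 1

/-- `M_c = (c − 1) I + J`. [cite: LeeWeiDeWolf2017, §6.2 (p13)] -/
theorem lwdwMc_eq (n : ℕ) (c : ℝ) : lwdwMc n c = (c - 1) • (1 : Matrix (Fin n) (Fin n) ℝ) + lwdwJ n := by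
  ext i j
  simp only [lwdwMc, lwdwJ, Matrix.of_apply, Matrix.add_apply, Matrix.smul_apply, Matrix.one_apply,
    smul_eq_mul, mul_ite, mul_one, mul_zero]
  split_ifs <;> ring

/-- `J² = n J`. [folklore] -/
private theorem lwdwJ_mul_lwdwJ (n : ℕ) : lwdwJ n * lwdwJ n = (n : ℝ) • lwdwJ n := by
  ext i j
  simp [lwdwJ, Matrix.mul_apply]

/-- **`rank M_c = n`** for `c ≠ 1` and `c − 1 + n ≠ 0` (explicit inverse
`(c−1)⁻¹ (I − J/(c−1+n))`), the input of "`B₁(M_c) = √n`" (Fact 4: `B₁ = √rank`).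
[cite: LeeWeiDeWolf2017, §6.2 (p13, "Combined with B₁(M_c) = √n") and Fact 4 (p05)] -/
theorem rank_lwdwMc {n : ℕ} {c : ℝ} (hc1 : c ≠ 1) (hcn : c - 1 + n ≠ 0) : (lwdwMc n c).rank = n := by
  classical
  have hc : c - 1 ≠ 0 := sub_ne_zero.mpr hc1
  set B : Matrix (Fin n) (Fin n) ℝ := (c - 1)⁻¹ • ((1 : Matrix (Fin n) (Fin n) ℝ) - (c - 1 + n)⁻¹ • lwdwJ n)
    with hB
  have hinv : lwdwMc n c * B = 1 := by
    rw [lwdwMc_eq, hB, Matrix.mul_smul, add_mul, Matrix.smul_mul, Matrix.one_mul, mul_sub,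
      Matrix.mul_one, Matrix.mul_smul, lwdwJ_mul_lwdwJ]
    -- scalar bookkeeping on the two "coordinates" `1` and `J`
    have key : (c - 1)⁻¹ • ((c - 1) • ((1 : Matrix (Fin n) (Fin n) ℝ) - (c - 1 + ↑n)⁻¹ • lwdwJ n) +
        (lwdwJ n - (c - 1 + ↑n)⁻¹ • ((n : ℝ) • lwdwJ n))) =
        ((c - 1)⁻¹ * (c - 1)) • (1 : Matrix (Fin n) (Fin n) ℝ) +
          ((c - 1)⁻¹ - (c - 1)⁻¹ * (c - 1) * (c - 1 + ↑n)⁻¹ - (c - 1)⁻¹ * (c - 1 + ↑n)⁻¹ * n) •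
            lwdwJ n := by
      module
    rw [key, inv_mul_cancel₀ hc, one_smul, one_mul]
    have hz : (c - 1)⁻¹ - (c - 1 + ↑n)⁻¹ - (c - 1)⁻¹ * (c - 1 + ↑n)⁻¹ * n = 0 := by
      field_simp
      ring
    rw [hz, zero_smul, add_zero]
  haveI : Invertible (lwdwMc n c) := invertibleOfRightInverse _ _ hinv
  rw [Matrix.rank_of_isUnit _ (isUnit_of_invertible _), Fintype.card_fin]

/-- **"Combined with `B₁(M_c) = √n`"** (complex factors, Fact 4: `rank ≤ r²`): for `c ≥ 0`, `c ≠ 1`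
(and `(n, c) ≠ (1, 0)`), every complex psd factorization of `M_c` has size `r` with `n ≤ r²`; so
Theorem 46's `O(c√n)` is tight up to the factor `O(c)`. [cite: LeeWeiDeWolf2017, §6.2 (p13) and Fact 4 (p05)] -/
theorem le_sq_of_hasComplexPsdFactorization_lwdwMc {n r : ℕ} {c : ℝ} (hc1 : c ≠ 1) (hcn : c - 1 + n ≠ 0)
    (h : HasComplexPsdFactorization (lwdwMc n c) r) : n ≤ r ^ 2 := by
  have h1 := h.rank_le_sq
  rwa [rank_lwdwMc hc1 hcn] at h1

/-- The real form (`rank ≤ C(r+1,2)`, FGPRT Prop. 2.5): every real psd factorization of `M_c` (`c ≠ 1`,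
`c − 1 + n ≠ 0`) has size `r` with `n ≤ r(r+1)/2`, i.e. `r ≥ (√(8n+1) − 1)/2 ≈ √(2n)` — matching the
second clause of Theorem 46 up to `+2`. [cite: LeeWeiDeWolf2017, §6.2 (p13) and Fact 4 (p05)] -/
theorem le_choose_of_hasPsdFactorization_lwdwMc {n r : ℕ} {c : ℝ} (hc1 : c ≠ 1) (hcn : c - 1 + n ≠ 0)
    (h : HasPsdFactorization (lwdwMc n c) r) : n ≤ (r + 1).choose 2 := by
  have h1 := FawziEtAl2015_prop25_rank_holds _ _ (lwdwMc n c) r h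
  rwa [rank_lwdwMc hc1 hcn] at h1

/-! ### The rank of an `ε`-approximation of the identity (§6.2, p13, after Alon) -/

/-- The rank of a real matrix does not increase under `ℝ → ℂ` (vanishing minors). [folklore] -/
private theorem rank_map_ofReal_le {ι κ : Type*} [Fintype ι] [Fintype κ] (A : Matrix ι κ ℝ) :
    (A.map ((↑) : ℝ → ℂ)).rank ≤ A.rank := by
  classical
  refine Literature.LinearAlgebra.Matrix.rank_le_of_det_submatrix_eq_zero _ fun r c => ?_
  have hmap : A.map ((↑) : ℝ → ℂ) = A.map Complex.ofRealHom := rfl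
  rw [hmap, Matrix.submatrix_map, ← RingHom.mapMatrix_apply, ← RingHom.map_det,
    Literature.LinearAlgebra.Matrix.det_submatrix_eq_zero_of_rank_lt_card A r c (by simp), map_zero]

/-- **LWdW §6.2, the rank of an approximation of the identity** (p13, verbatim: "We say that an
`n`-by-`n` matrix `A` is an `ε`-approximation of the identity if `A(i,i) = 1` for all `i ∈ [n]` and
`0 ≤ A(i,j) ≤ ε` for all `i ≠ j`. The usual rank of approximations of the identity has been well studied
[Alo09]. In particular, it is easy to show that if `A` is an `ε`-approximation of the identity then
`rank(A) ≥ n/(1 + ε²(n−1))`."), in the product form `n ≤ rank(A)·(1 + ε²(n−1))` and under the weaker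
hypothesis `|A(i,j)| ≤ ε` off the diagonal. Proof (the standard one): `|tr A|² ≤ rank A · Σ_{i,j} |a_ij|²`
(the tree's Horn–Johnson 2.4.P2, `norm_trace_sq_le_rank_mul`, over `ℂ`) with `tr A = n`,
`Σ|a_ij|² ≤ n + n(n−1)ε²`. [cite: LeeWeiDeWolf2017, §6.2 (p13)] -/
theorem LeeWeiDeWolf2017_rank_approxIdentity {n : ℕ} {A : Matrix (Fin n) (Fin n) ℝ} {ε : ℝ}
    (hdiag : ∀ i, A i i = 1) (hoff : ∀ i j, i ≠ j → |A i j| ≤ ε) :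
    (n : ℝ) ≤ A.rank * (1 + ε ^ 2 * (n - 1)) := by
  classical
  rcases Nat.eq_zero_or_pos n with hn | hn
  · subst hn
    have : A.rank = 0 := le_antisymm (by simpa using Matrix.rank_le_card_width A) (Nat.zero_le _)
    simp [this]
  set B : Matrix (Fin n) (Fin n) ℂ := A.map ((↑) : ℝ → ℂ) with hB
  have htr : B.trace = n := by
    simp [hB, Matrix.trace, hdiag]
  -- `Σ |b_ij|² ≤ n (1 + ε²(n−1))`
  have hrow : ∀ i, ∑ j, ‖B i j‖ ^ 2 ≤ 1 + ε ^ 2 * (n - 1) := by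
    intro i
    rw [← Finset.add_sum_erase _ _ (Finset.mem_univ i)]
    have h1 : ‖B i i‖ ^ 2 = 1 := by simp [hB, hdiag]
    have h2 : ∑ j ∈ Finset.univ.erase i, ‖B i j‖ ^ 2 ≤ ∑ j ∈ Finset.univ.erase i, ε ^ 2 :=
      Finset.sum_le_sum fun j hj => by
        have hne : i ≠ j := (Finset.ne_of_mem_erase hj).symm
        simp only [hB, Matrix.map_apply, Complex.norm_real, Real.norm_eq_abs]
        exact pow_le_pow_left₀ (abs_nonneg _) (hoff i j hne) 2
    rw [Finset.sum_const, Finset.card_erase_of_mem (Finset.mem_univ i), Finset.card_univ,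
      Fintype.card_fin, nsmul_eq_mul, Nat.cast_sub hn, Nat.cast_one] at h2
    rw [h1]
    linarith
  have hsum : ∑ i, ∑ j, ‖B i j‖ ^ 2 ≤ n * (1 + ε ^ 2 * (n - 1)) := by
    calc ∑ i, ∑ j, ‖B i j‖ ^ 2 ≤ ∑ _i : Fin n, (1 + ε ^ 2 * (n - 1)) :=
          Finset.sum_le_sum fun i _ => hrow i
      _ = n * (1 + ε ^ 2 * (n - 1)) := by
          rw [Finset.sum_const, Finset.card_univ, Fintype.card_fin, nsmul_eq_mul]
  have key := Literature.LinearAlgebra.Matrix.RankEigenvalueTraceBound.norm_trace_sq_le_rank_mul B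
  rw [htr] at key
  simp only [Complex.norm_natCast] at key
  have hrk : (B.rank : ℝ) ≤ A.rank := by exact_mod_cast rank_map_ofReal_le A
  have hn0 : (0 : ℝ) < n := by exact_mod_cast hn
  have h3 : (n : ℝ) ^ 2 ≤ A.rank * (n * (1 + ε ^ 2 * (n - 1))) := by
    calc (n : ℝ) ^ 2 ≤ B.rank * ∑ i, ∑ j, ‖B i j‖ ^ 2 := key
      _ ≤ A.rank * ∑ i, ∑ j, ‖B i j‖ ^ 2 :=
          mul_le_mul_of_nonneg_right hrk (Finset.sum_nonneg fun i _ => Finset.sum_nonneg fun j _ => sq_nonneg _)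
      _ ≤ A.rank * (n * (1 + ε ^ 2 * (n - 1))) := mul_le_mul_of_nonneg_left hsum (Nat.cast_nonneg _)
  have h4 : (n : ℝ) * n ≤ n * (A.rank * (1 + ε ^ 2 * (n - 1))) := by rw [← sq]; linarith
  exact le_of_mul_le_mul_left h4 hn0

/-- The printed quotient form `rank(A) ≥ n/(1 + ε²(n−1))` for an `ε`-approximation of the identity
(`A(i,i) = 1`, `0 ≤ A(i,j) ≤ ε`), in the hypothesis shape of the tree's `LeeWeiDeWolf2017_thm43_real`.
[cite: LeeWeiDeWolf2017, §6.2 (p13)] -/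
theorem LeeWeiDeWolf2017_rank_approxIdentity_div {n : ℕ} {A : Matrix (Fin n) (Fin n) ℝ} {ε : ℝ}
    (hdiag : ∀ i, A i i = 1) (hoff : ∀ i j, i ≠ j → 0 ≤ A i j ∧ A i j ≤ ε) :
    (n : ℝ) / (1 + ε ^ 2 * (n - 1)) ≤ A.rank := by
  have h := LeeWeiDeWolf2017_rank_approxIdentity hdiag fun i j hij => by
    rw [abs_of_nonneg (hoff i j hij).1]; exact (hoff i j hij).2
  rcases Nat.eq_zero_or_pos n with hn | hn
  · subst hn; simp
  have hden : 0 < 1 + ε ^ 2 * ((n : ℝ) - 1) := by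
    have : (0 : ℝ) ≤ (n : ℝ) - 1 := by
      have : (1 : ℝ) ≤ n := by exact_mod_cast hn
      linarith
    positivity
  rw [div_le_iff₀ hden]
  exact h

/-- **The contrast the text draws** (p13: "Using the bound `B₄` we can show a very analogous result
for PSD-rank", Theorem 43: `rank_psd(A) ≥ n/(1 + ε(n−1))`): for the matrices `M_c/(c+1)`-type
example `A = offDiagConst n ε` (`1` on the diagonal, `ε` off it, `0 ≤ ε < 1`) the rank is full, `n`, while
Theorem 46 gives psd factorizations of size `O(√n)` for `ε ≥ 1/3`; here just the rank:
`rank(offDiagConst n ε) = n`. [cite: LeeWeiDeWolf2017, §6.2 (p13–p14)] -/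
theorem rank_offDiagConst {n : ℕ} {ε : ℝ} (hε0 : 0 ≤ ε) (hε1 : ε < 1) : (offDiagConst n ε).rank = n := by
  rcases Nat.eq_zero_or_pos n with hn | hn
  · subst hn
    exact le_antisymm (by simpa using Matrix.rank_le_card_width (offDiagConst 0 ε)) (Nat.zero_le _)
  rcases hε0.eq_or_lt with h0 | hpos
  · -- `ε = 0`: the identity
    have : offDiagConst n ε = 1 := by
      ext i j
      simp [offDiagConst, ← h0, Matrix.one_apply]
    rw [this, Matrix.rank_one, Fintype.card_fin]
  · -- `ε > 0`: `offDiagConst n ε = ε • M_c` with `c = 1/ε > 1`, and `rank M_c = n`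
    have hc : offDiagConst n ε = ε • lwdwMc n (1 / ε) := by
      ext i j
      by_cases h : i = j
      · simp [offDiagConst, lwdwMc, h, hpos.ne']
      · simp [offDiagConst, lwdwMc, h]
    have hunit : IsUnit ((ε • (1 : Matrix (Fin n) (Fin n) ℝ))).det := by
      rw [Matrix.det_smul, Matrix.det_one, mul_one]
      exact (pow_ne_zero _ hpos.ne').isUnit
    have h1 : ε • lwdwMc n (1 / ε) = (ε • (1 : Matrix (Fin n) (Fin n) ℝ)) * lwdwMc n (1 / ε) := by
      rw [Matrix.smul_mul, Matrix.one_mul]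
    rw [hc, h1, Matrix.rank_mul_eq_right_of_isUnit_det _ _ hunit]
    have hc1 : 1 < 1 / ε := by rw [one_div, one_lt_inv_iff₀]; exact ⟨hpos, hε1⟩
    exact rank_lwdwMc hc1.ne' (by positivity)

/-- **The `B₁` consequence** (how the text passes from rank to psd-rank, p14: "Combining the above
theorem and Fact 4, we immediately obtain …", Fact 4 = `rank(A) ≤ rank_psd(A)²`, the tree's
`HasComplexPsdFactorization.rank_le_sq`): every complex psd factorization of size `r` of a matrix with
unit diagonal and off-diagonal entries of modulus `≤ ε` (`n ≥ 1`) has `n ≤ r²(1 + ε²(n−1))`.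
[cite: LeeWeiDeWolf2017, §6.2 (p13–p14) with Fact 4 (p05)] -/
theorem LeeWeiDeWolf2017_approxIdentity_complexPsd {n r : ℕ} (hn : 1 ≤ n) {A : Matrix (Fin n) (Fin n) ℝ}
    {ε : ℝ} (hdiag : ∀ i, A i i = 1) (hoff : ∀ i j, i ≠ j → |A i j| ≤ ε)
    (hA : HasComplexPsdFactorization A r) : (n : ℝ) ≤ (r : ℝ) ^ 2 * (1 + ε ^ 2 * (n - 1)) := by
  have h1 := LeeWeiDeWolf2017_rank_approxIdentity hdiag hoff
  have h2 : (A.rank : ℝ) ≤ (r : ℝ) ^ 2 := by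
    have := hA.rank_le_sq
    exact_mod_cast this
  have hden : 0 ≤ 1 + ε ^ 2 * ((n : ℝ) - 1) := by
    have : (1 : ℝ) ≤ n := by exact_mod_cast hn
    nlinarith [sq_nonneg ε]
  exact h1.trans (mul_le_mul_of_nonneg_right h2 hden)

/-- The same for REAL psd factorizations, through FGPRT Prop. 2.5 (`rank ≤ C(r+1, 2)`, the tree's
`FawziEtAl2015_prop25_rank_holds`): `n ≤ C(r+1,2)(1 + ε²(n−1))`.
[cite: LeeWeiDeWolf2017, §6.2 (p13–p14) with Fact 4 (p05)] -/
theorem LeeWeiDeWolf2017_approxIdentity_realPsd {n r : ℕ} (hn : 1 ≤ n) {A : Matrix (Fin n) (Fin n) ℝ}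
    {ε : ℝ} (hdiag : ∀ i, A i i = 1) (hoff : ∀ i j, i ≠ j → |A i j| ≤ ε)
    (hA : HasPsdFactorization (fun i j => A i j) r) :
    (n : ℝ) ≤ ((r + 1).choose 2 : ℕ) * (1 + ε ^ 2 * (n - 1)) := by
  have h1 := LeeWeiDeWolf2017_rank_approxIdentity hdiag hoff
  have h2 : (A.rank : ℝ) ≤ ((r + 1).choose 2 : ℕ) := by
    have := FawziEtAl2015_prop25_rank_holds _ _ A r hA
    exact_mod_cast this
  have hden : 0 ≤ 1 + ε ^ 2 * ((n : ℝ) - 1) := by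
    have : (1 : ℝ) ≤ n := by exact_mod_cast hn
    nlinarith [sq_nonneg ε]
  exact h1.trans (mul_le_mul_of_nonneg_right h2 hden)

/-! ### Proposition 42: `rank_psd(J − A)` and `rank_psd(A)` can be arbitrarily far apart -/

/-- **LWdW Proposition 42** (p13, verbatim: "For every positive integer `d`, there exists a nonnegative
matrix `A`, such that `J − A` is also nonnegative, and `|rank_psd(J−A) − rank_psd(A)| > d`, where `J` is
the all-one matrix." Proof: "Choose `A = I`, and the size to be `n`, then we have that
`rank_psd(J−A) ≈ √n`, while `rank_psd(A) = n`."). Typed with explicit witnesses for the complex psd rank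
as printed: `A = I_n` with `n = 2(d+2)²`; `J − A` (the nonequality matrix) has a (real, hence complex)
psd factorization of size `⌈√(2n)⌉ + 1 = 2d + 5` (Theorem 46), while every complex psd factorization of
`A` has size `≥ n` (Theorem 43 with `ε = 0`), and `n − (2d+5) > d`.
[cite: LeeWeiDeWolf2017, Prop. 42 (p13)] -/
theorem LeeWeiDeWolf2017_prop42 (d : ℕ) :
    ∃ (n : ℕ) (A : Matrix (Fin n) (Fin n) ℝ), (∀ i j, 0 ≤ A i j ∧ A i j ≤ 1) ∧
      ∃ r : ℕ, HasComplexPsdFactorization (fun i j => 1 - A i j) r ∧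
        ∀ s : ℕ, HasComplexPsdFactorization A s → r + d < s := by
  refine ⟨2 * (d + 2) ^ 2, 1, fun i j => ?_, ⌈Real.sqrt (2 * (2 * (d + 2) ^ 2 : ℕ))⌉₊ + 1, ?_, ?_⟩
  · by_cases h : i = j
    · subst h; simp
    · simp [h]
  · -- `J − I` is the nonequality matrix
    have heq : (fun i j : Fin (2 * (d + 2) ^ 2) => (1 : ℝ) - (1 : Matrix _ _ ℝ) i j) =
        derangementMatrix (2 * (d + 2) ^ 2) := by
      funext i j
      by_cases h : i = j
      · subst h; simp [derangementMatrix]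
      · simp [h, derangementMatrix]
    rw [heq]
    exact (LeeWeiDeWolf2017_thm46_nonequality _).toComplex
  · intro s hs
    -- `⌈√(2n)⌉ = 2(d+2)` for `n = 2(d+2)²`
    have hsq : Real.sqrt (2 * (2 * (d + 2) ^ 2 : ℕ)) = (2 * (d + 2) : ℕ) := by
      rw [show ((2 * (2 * (d + 2) ^ 2 : ℕ) : ℝ)) = ((2 * (d + 2) : ℕ) : ℝ) ^ 2 by push_cast; ring]
      exact Real.sqrt_sq (by positivity)
    rw [hsq, Nat.ceil_natCast]
    -- every complex psd factorization of `I_n` has size `≥ n`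
    have hn : 1 ≤ 2 * (d + 2) ^ 2 := by
      have : 1 ≤ (d + 2) ^ 2 := Nat.one_le_pow _ _ (by omega)
      omega
    have h := LeeWeiDeWolf2017_thm43 (r := s) hn (A := fun i j => (1 : Matrix _ _ ℝ) i j) (ε := 0) le_rfl
      (fun i => by simp) (fun i j hij => by simp [hij]) hs
    simp only [zero_mul, add_zero, mul_one] at h
    have h' : 2 * (d + 2) ^ 2 ≤ s := by exact_mod_cast h
    nlinarith

/-- **Proposition 42 for the real psd rank** (same witnesses; `rank_psd^ℝ(I_n) = n` is FGPRT Ex. 2.11,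
the tree's `hasPsdFactorization_one_iff`). [cite: LeeWeiDeWolf2017, Prop. 42 (p13)] -/
theorem LeeWeiDeWolf2017_prop42_real (d : ℕ) :
    ∃ (n : ℕ) (A : Matrix (Fin n) (Fin n) ℝ), (∀ i j, 0 ≤ A i j ∧ A i j ≤ 1) ∧
      ∃ r : ℕ, HasPsdFactorization (fun i j => 1 - A i j) r ∧
        ∀ s : ℕ, HasPsdFactorization (fun i j => A i j) s → r + d < s := by
  classical
  refine ⟨2 * (d + 2) ^ 2, 1, fun i j => ?_, ⌈Real.sqrt (2 * (2 * (d + 2) ^ 2 : ℕ))⌉₊ + 1, ?_, ?_⟩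
  · by_cases h : i = j
    · subst h; simp
    · simp [h]
  · have heq : (fun i j : Fin (2 * (d + 2) ^ 2) => (1 : ℝ) - (1 : Matrix _ _ ℝ) i j) =
        derangementMatrix (2 * (d + 2) ^ 2) := by
      funext i j
      by_cases h : i = j
      · subst h; simp [derangementMatrix]
      · simp [h, derangementMatrix]
    rw [heq]
    exact LeeWeiDeWolf2017_thm46_nonequality _
  · intro s hs
    have hsq : Real.sqrt (2 * (2 * (d + 2) ^ 2 : ℕ)) = (2 * (d + 2) : ℕ) := by
      rw [show ((2 * (2 * (d + 2) ^ 2 : ℕ) : ℝ)) = ((2 * (d + 2) : ℕ) : ℝ) ^ 2 by push_cast; ring]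
      exact Real.sqrt_sq (by positivity)
    rw [hsq, Nat.ceil_natCast]
    have hs' : HasPsdFactorization (1 : Matrix (Fin (2 * (d + 2) ^ 2)) (Fin (2 * (d + 2) ^ 2)) ℝ) s := hs
    have h := (hasPsdFactorization_one_iff.mp hs')
    rw [Fintype.card_fin] at h
    nlinarith

end ApproximateIdentity

end Literature.Combinatorics.Optimization
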